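import Summits.FinalStateConjecture.FinalStateConjecture.Theorems.UniformPhotonSphereChannels.Negative.EnergyDefectIdentity

/-!
# Route EIHFluxBalance — `RecedingWellsEnergyBound`: energy–flux calculus for a time-dependent potential

Second helper file for the support item stmt-FinalStateConjecture-10168
(`Summit.FinalStateConjecture.FinalStateConjecture.Theses.EIHFluxBalance.RecedingWellsEnergyBound`).
The PhotonSphereChannels calculus (`WaveEnergy.*`) treats `u_tt − u_xx + V(x) u = 0` with a STATIC
potential; the receding-wells toy has `W(t, x) = V(x − vt) + V(x + vt)`.  For a general
differentiable `W : ℝ × ℝ → ℝ` and a `C²` function `u : ℝ × ℝ → ℝ` (`z = (t, x)`, Fréchet partials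
`u_t = ∂u(z)(1,0)`, `u_x = ∂u(z)(0,1)`) we record, in the hypothesis-style of the toolkit (densities
passed as functions with defining hypotheses, no definitions):

* the densities `e = u_t² + u_x² + W u²` (energy), `m = 2 u_t u_x` (momentum) and
  `n = u_t² + u_x² − W u²`, their differentiability and slice derivatives (the `e`-facts
  `differentiable_energyDensity`, `hasDerivAt_energyDensity_slice_fst`, `energyDensity_nonneg` are
  REUSED from `WaveDefect`, file `UniformPhotonSphereChannels/Negative/EnergyDefectIdentity`);
* the positivity facts `|m| ≤ u_t² + u_x² ≤ e` for `W ≥ 0`;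
* the **weighted divergence identity** (`divergence_weighted`): for differentiable weights
  `ρ σ β : ℝ × ℝ → ℝ` and a solution `u`, the pair `q = ρ e + σ u² + β m`, `g = −(ρ m + β n)` has
  `∂ₜ q + ∂ₓ g = ρ_t e − ρ_x m + β_t m − β_x n + (ρ W_t + β W_x + σ_t) u² + 2 σ u u_t`
  — the local conservation laws `∂ₜ e = ∂ₓ m + W_t u²`, `∂ₜ m = ∂ₓ n + W_x u²` in one statement.
  Its instances are the Grönwall-weighted energies (`ρ = σ = e^{−Kt}`), the cut-off mass term
  (`σ = e^{−Kt} χ(x)`) and the Doppler multiplier (`β = v φ(x / b(t))`) of the sequel files.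

Standard material [folklore]; no source formalises it.
-/

namespace Summit.FinalStateConjecture.FinalStateConjecture.Theorems

open MeasureTheory Set Filter Topology intervalIntegral

noncomputable section

namespace MovingWells

open WaveEnergy

variable {u W : ℝ × ℝ → ℝ}

/-! ### The three densities `e`, `m`, `n` -/

/-- The density `n = u_t² + u_x² − W u²` is differentiable. -/
theorem differentiable_lagr (hu : ContDiff ℝ 2 u) (hW : Differentiable ℝ W) {n : ℝ × ℝ → ℝ}
    (hn : ∀ z, n z = (fderiv ℝ u z (1, 0)) ^ 2 + (fderiv ℝ u z (0, 1)) ^ 2 - W z * u z ^ 2) :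
    Differentiable ℝ n := by
  have h1 := differentiable_fderiv_apply hu (1, 0)
  have h2 := differentiable_fderiv_apply hu (0, 1)
  have h3 := differentiable_of_contDiff_two hu
  rw [show n = _ from funext hn]
  exact ((h1.pow 2).add (h2.pow 2)).sub (hW.mul (h3.pow 2))

/-- The energy density is continuous when `W` is. -/
theorem continuous_energy (hu : ContDiff ℝ 2 u) (hW : Continuous W) {e : ℝ × ℝ → ℝ}
    (he : ∀ z, e z = (fderiv ℝ u z (1, 0)) ^ 2 + (fderiv ℝ u z (0, 1)) ^ 2 + W z * u z ^ 2) :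
    Continuous e := by
  have h1 := continuous_fderiv_apply hu (1, 0)
  have h2 := continuous_fderiv_apply hu (0, 1)
  have h3 := (differentiable_of_contDiff_two hu).continuous
  rw [show e = _ from funext he]
  exact ((h1.pow 2).add (h2.pow 2)).add (hW.mul (h3.pow 2))

/-- The density `n` is continuous when `W` is. -/
theorem continuous_lagr (hu : ContDiff ℝ 2 u) (hW : Continuous W) {n : ℝ × ℝ → ℝ}
    (hn : ∀ z, n z = (fderiv ℝ u z (1, 0)) ^ 2 + (fderiv ℝ u z (0, 1)) ^ 2 - W z * u z ^ 2) :
    Continuous n := by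
  have h1 := continuous_fderiv_apply hu (1, 0)
  have h2 := continuous_fderiv_apply hu (0, 1)
  have h3 := (differentiable_of_contDiff_two hu).continuous
  rw [show n = _ from funext hn]
  exact ((h1.pow 2).add (h2.pow 2)).sub (hW.mul (h3.pow 2))

/-- With `W ≥ 0`: `m ≤ u_t² + u_x²`. -/
theorem momentum_le_kinetic {m : ℝ × ℝ → ℝ}
    (hm : ∀ z, m z = 2 * fderiv ℝ u z (1, 0) * fderiv ℝ u z (0, 1)) (z : ℝ × ℝ) :
    m z ≤ (fderiv ℝ u z (1, 0)) ^ 2 + (fderiv ℝ u z (0, 1)) ^ 2 := by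
  rw [hm]
  nlinarith [sq_nonneg (fderiv ℝ u z (1, 0) - fderiv ℝ u z (0, 1))]

/-- `−m ≤ u_t² + u_x²`. -/
theorem neg_momentum_le_kinetic {m : ℝ × ℝ → ℝ}
    (hm : ∀ z, m z = 2 * fderiv ℝ u z (1, 0) * fderiv ℝ u z (0, 1)) (z : ℝ × ℝ) :
    -m z ≤ (fderiv ℝ u z (1, 0)) ^ 2 + (fderiv ℝ u z (0, 1)) ^ 2 := by
  rw [hm]
  nlinarith [sq_nonneg (fderiv ℝ u z (1, 0) + fderiv ℝ u z (0, 1))]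

/-- `|m| ≤ u_t² + u_x²`. -/
theorem abs_momentum_le_kinetic {m : ℝ × ℝ → ℝ}
    (hm : ∀ z, m z = 2 * fderiv ℝ u z (1, 0) * fderiv ℝ u z (0, 1)) (z : ℝ × ℝ) :
    |m z| ≤ (fderiv ℝ u z (1, 0)) ^ 2 + (fderiv ℝ u z (0, 1)) ^ 2 :=
  abs_le.mpr ⟨by linarith [neg_momentum_le_kinetic hm z], momentum_le_kinetic hm z⟩

/-- With `W ≥ 0` the energy density dominates the kinetic part: `u_t² + u_x² ≤ e`. -/
theorem kinetic_le_energy (hW0 : ∀ z, 0 ≤ W z) {e : ℝ × ℝ → ℝ}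
    (he : ∀ z, e z = (fderiv ℝ u z (1, 0)) ^ 2 + (fderiv ℝ u z (0, 1)) ^ 2 + W z * u z ^ 2)
    (z : ℝ × ℝ) : (fderiv ℝ u z (1, 0)) ^ 2 + (fderiv ℝ u z (0, 1)) ^ 2 ≤ e z := by
  rw [he]
  nlinarith [mul_nonneg (hW0 z) (sq_nonneg (u z))]

/-! ### Slice derivatives -/

/-- `∂ₜ m` along a `t`-slice: `2 (u_tt u_x + u_t u_xt)`. -/
theorem hasDerivAt_momentum_slice_fst (hu : ContDiff ℝ 2 u) {m : ℝ × ℝ → ℝ}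
    (hm : ∀ z, m z = 2 * fderiv ℝ u z (1, 0) * fderiv ℝ u z (0, 1)) (t x : ℝ) :
    HasDerivAt (fun τ => m (τ, x))
      (2 * (fderiv ℝ (fderiv ℝ u) (t, x) (1, 0) (1, 0) * fderiv ℝ u (t, x) (0, 1)
        + fderiv ℝ u (t, x) (1, 0) * fderiv ℝ (fderiv ℝ u) (t, x) (1, 0) (0, 1))) t := by
  have h1 := hasDerivAt_fderiv_apply_slice_fst hu (1, 0) t x
  have h2 := hasDerivAt_fderiv_apply_slice_fst hu (0, 1) t x
  have h := (h1.mul h2).const_mul 2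
  have hfun : (fun τ => m (τ, x))
      = fun τ => 2 * (fderiv ℝ u (τ, x) (1, 0) * fderiv ℝ u (τ, x) (0, 1)) :=
    funext fun τ => by rw [hm]; ring
  rw [hfun]
  refine h.congr_deriv ?_
  ring

/-- `∂ₓ n` along an `x`-slice: `2 u_t u_tx + 2 u_x u_xx − W_x u² − 2 W u u_x`. -/
theorem hasDerivAt_lagr_slice_snd (hu : ContDiff ℝ 2 u) (hW : Differentiable ℝ W)
    {n : ℝ × ℝ → ℝ}
    (hn : ∀ z, n z = (fderiv ℝ u z (1, 0)) ^ 2 + (fderiv ℝ u z (0, 1)) ^ 2 - W z * u z ^ 2)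
    (t x : ℝ) :
    HasDerivAt (fun y => n (t, y))
      (2 * fderiv ℝ u (t, x) (1, 0) * fderiv ℝ (fderiv ℝ u) (t, x) (0, 1) (1, 0)
        + 2 * fderiv ℝ u (t, x) (0, 1) * fderiv ℝ (fderiv ℝ u) (t, x) (0, 1) (0, 1)
        - fderiv ℝ W (t, x) (0, 1) * u (t, x) ^ 2
        - W (t, x) * (2 * u (t, x) * fderiv ℝ u (t, x) (0, 1))) x := by
  have h1 := hasDerivAt_fderiv_apply_slice_snd hu (1, 0) t x
  have h2 := hasDerivAt_fderiv_apply_slice_snd hu (0, 1) t x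
  have h3 := hasDerivAt_slice_snd (differentiable_of_contDiff_two hu) t x
  have h4 := hasDerivAt_slice_snd hW t x
  have h := ((h1.pow 2).add (h2.pow 2)).sub (h4.mul (h3.pow 2))
  have hfun : (fun y => n (t, y)) = fun y =>
      (fderiv ℝ u (t, y) (1, 0)) ^ 2 + (fderiv ℝ u (t, y) (0, 1)) ^ 2 - W (t, y) * u (t, y) ^ 2 :=
    funext fun y => hn (t, y)
  rw [hfun]
  refine h.congr_deriv ?_
  simp only [Pi.pow_apply]
  push_cast
  ring

/-! ### Weighted energies `q = ρ e + σ u² + β m` and their divergence -/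

section Weighted

variable {e m n ρ σ β q g : ℝ × ℝ → ℝ}

/-- The weighted density `q = ρ e + σ u² + β m` is differentiable. -/
theorem differentiable_weighted (hu : ContDiff ℝ 2 u) (hW : Differentiable ℝ W)
    (he : ∀ z, e z = (fderiv ℝ u z (1, 0)) ^ 2 + (fderiv ℝ u z (0, 1)) ^ 2 + W z * u z ^ 2)
    (hm : ∀ z, m z = 2 * fderiv ℝ u z (1, 0) * fderiv ℝ u z (0, 1))
    (hρ : Differentiable ℝ ρ) (hσ : Differentiable ℝ σ) (hβ : Differentiable ℝ β)
    (hq : ∀ z, q z = ρ z * e z + σ z * u z ^ 2 + β z * m z) : Differentiable ℝ q := by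
  rw [show q = _ from funext hq]
  exact ((hρ.mul (WaveDefect.differentiable_energyDensity hu hW he)).add
    (hσ.mul ((differentiable_of_contDiff_two hu).pow 2))).add
    (hβ.mul (differentiable_momentumDensity hu hm))

/-- The weighted flux `g = −(ρ m + β n)` is differentiable. -/
theorem differentiable_weightedFlux (hu : ContDiff ℝ 2 u) (hW : Differentiable ℝ W)
    (hm : ∀ z, m z = 2 * fderiv ℝ u z (1, 0) * fderiv ℝ u z (0, 1))
    (hn : ∀ z, n z = (fderiv ℝ u z (1, 0)) ^ 2 + (fderiv ℝ u z (0, 1)) ^ 2 - W z * u z ^ 2)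
    (hρ : Differentiable ℝ ρ) (hβ : Differentiable ℝ β)
    (hg : ∀ z, g z = -(ρ z * m z + β z * n z)) : Differentiable ℝ g := by
  rw [show g = _ from funext hg]
  exact ((hρ.mul (differentiable_momentumDensity hu hm)).add
    (hβ.mul (differentiable_lagr hu hW hn))).neg

/-- **Weighted divergence identity.** For a `C²` solution of `u_tt − u_xx + W u = 0`
(`W` differentiable) and differentiable weights `ρ σ β`, the pair `q = ρ e + σ u² + β m`,
`g = −(ρ m + β n)` satisfies
`∂ₜ q + ∂ₓ g = ρ_t e − ρ_x m + β_t m − β_x n + (ρ W_t + β W_x + σ_t) u² + 2 σ u u_t`.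
(With `ρ = 1`, `σ = β = 0` this is `∂ₜ e − ∂ₓ m = W_t u²`; with `β = 1`, `ρ = σ = 0` it is
`∂ₜ m − ∂ₓ n = W_x u²`.) [folklore] -/
theorem divergence_weighted (hu : ContDiff ℝ 2 u) (hW : Differentiable ℝ W)
    (hsol : ∀ z : ℝ × ℝ, fderiv ℝ (fderiv ℝ u) z (1, 0) (1, 0)
      - fderiv ℝ (fderiv ℝ u) z (0, 1) (0, 1) + W z * u z = 0)
    (he : ∀ z, e z = (fderiv ℝ u z (1, 0)) ^ 2 + (fderiv ℝ u z (0, 1)) ^ 2 + W z * u z ^ 2)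
    (hm : ∀ z, m z = 2 * fderiv ℝ u z (1, 0) * fderiv ℝ u z (0, 1))
    (hn : ∀ z, n z = (fderiv ℝ u z (1, 0)) ^ 2 + (fderiv ℝ u z (0, 1)) ^ 2 - W z * u z ^ 2)
    (hρ : Differentiable ℝ ρ) (hσ : Differentiable ℝ σ) (hβ : Differentiable ℝ β)
    (hq : ∀ z, q z = ρ z * e z + σ z * u z ^ 2 + β z * m z)
    (hg : ∀ z, g z = -(ρ z * m z + β z * n z)) (z : ℝ × ℝ) :
    fderiv ℝ q z (1, 0) + fderiv ℝ g z (0, 1)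
      = fderiv ℝ ρ z (1, 0) * e z - fderiv ℝ ρ z (0, 1) * m z
        + fderiv ℝ β z (1, 0) * m z - fderiv ℝ β z (0, 1) * n z
        + (ρ z * fderiv ℝ W z (1, 0) + β z * fderiv ℝ W z (0, 1) + fderiv ℝ σ z (1, 0)) * u z ^ 2
        + 2 * σ z * u z * fderiv ℝ u z (1, 0) := by
  obtain ⟨t, x⟩ := z
  have hud := differentiable_of_contDiff_two hu
  -- `t`-slice of `q`
  have hQ : HasDerivAt (fun τ => q (τ, x))
      (fderiv ℝ ρ (t, x) (1, 0) * e (t, x)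
        + ρ (t, x) * (2 * fderiv ℝ u (t, x) (1, 0) * fderiv ℝ (fderiv ℝ u) (t, x) (1, 0) (1, 0)
          + 2 * fderiv ℝ u (t, x) (0, 1) * fderiv ℝ (fderiv ℝ u) (t, x) (1, 0) (0, 1)
          + fderiv ℝ W (t, x) (1, 0) * u (t, x) ^ 2
          + W (t, x) * (2 * u (t, x) * fderiv ℝ u (t, x) (1, 0)))
        + (fderiv ℝ σ (t, x) (1, 0) * u (t, x) ^ 2
          + σ (t, x) * (2 * u (t, x) * fderiv ℝ u (t, x) (1, 0)))
        + (fderiv ℝ β (t, x) (1, 0) * m (t, x)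
          + β (t, x) * (2 * (fderiv ℝ (fderiv ℝ u) (t, x) (1, 0) (1, 0) * fderiv ℝ u (t, x) (0, 1)
            + fderiv ℝ u (t, x) (1, 0) * fderiv ℝ (fderiv ℝ u) (t, x) (1, 0) (0, 1))))) t := by
    have h1 := (hasDerivAt_slice_fst hρ t x).mul (WaveDefect.hasDerivAt_energyDensity_slice_fst hu hW he t x)
    have h2 := (hasDerivAt_slice_fst hσ t x).mul ((hasDerivAt_slice_fst hud t x).pow 2)
    have h3 := (hasDerivAt_slice_fst hβ t x).mul (hasDerivAt_momentum_slice_fst hu hm t x)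
    have h := (h1.add h2).add h3
    have hfun : (fun τ => q (τ, x))
        = fun τ => ρ (τ, x) * e (τ, x) + σ (τ, x) * u (τ, x) ^ 2 + β (τ, x) * m (τ, x) :=
      funext fun τ => hq (τ, x)
    rw [hfun]
    refine h.congr_deriv ?_
    simp only [Pi.pow_apply]
    push_cast
    ring
  -- `x`-slice of `g`
  have hG : HasDerivAt (fun y => g (t, y))
      (-((fderiv ℝ ρ (t, x) (0, 1) * m (t, x)
        + ρ (t, x) * (2 * (fderiv ℝ (fderiv ℝ u) (t, x) (0, 1) (1, 0) * fderiv ℝ u (t, x) (0, 1)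
          + fderiv ℝ u (t, x) (1, 0) * fderiv ℝ (fderiv ℝ u) (t, x) (0, 1) (0, 1))))
        + (fderiv ℝ β (t, x) (0, 1) * n (t, x)
          + β (t, x) * (2 * fderiv ℝ u (t, x) (1, 0) * fderiv ℝ (fderiv ℝ u) (t, x) (0, 1) (1, 0)
            + 2 * fderiv ℝ u (t, x) (0, 1) * fderiv ℝ (fderiv ℝ u) (t, x) (0, 1) (0, 1)
            - fderiv ℝ W (t, x) (0, 1) * u (t, x) ^ 2
            - W (t, x) * (2 * u (t, x) * fderiv ℝ u (t, x) (0, 1)))))) x := by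
    have h1 := (hasDerivAt_slice_snd hρ t x).mul (hasDerivAt_momentumDensity_slice_snd hu hm t x)
    have h3 := (hasDerivAt_slice_snd hβ t x).mul (hasDerivAt_lagr_slice_snd hu hW hn t x)
    have h := (h1.add h3).neg
    have hfun : (fun y => g (t, y))
        = fun y => -(ρ (t, y) * m (t, y) + β (t, y) * n (t, y)) :=
      funext fun y => hg (t, y)
    rw [hfun]
    exact h
  have hqd := differentiable_weighted hu hW he hm hρ hσ hβ hq
  have hgd := differentiable_weightedFlux hu hW hm hn hρ hβ hg
  rw [(hasDerivAt_slice_fst hqd t x).unique hQ, (hasDerivAt_slice_snd hgd t x).unique hG]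
  have hsymm := fderiv_fderiv_symm hu (t, x) (1, 0) (0, 1)
  have hs := hsol (t, x)
  linear_combination (2 * ρ (t, x) * fderiv ℝ u (t, x) (1, 0)
      + 2 * β (t, x) * fderiv ℝ u (t, x) (0, 1)) * hs
    + (2 * ρ (t, x) * fderiv ℝ u (t, x) (0, 1) + 2 * β (t, x) * fderiv ℝ u (t, x) (1, 0)) * hsymm

end Weighted

end MovingWells

end

end Summit.FinalStateConjecture.FinalStateConjecture.Theorems
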